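import Literature.NumberTheory.Transcendental.KZLogCalculusProofs

/-!
# Probe: helper-only file landed with `--supports` (crux LogPrimitiveNL, line logderiv-peeling)
-/

noncomputable section

open Set MeasureTheory
open Literature.NumberTheory.Transcendental Literature.ModelTheory.ExponentialFields

namespace Summit.KontsevichZagierPeriods.LiouvilleUnfolding.LogPrimitiveNL

/-- A representation whose integrand vanishes on its domain off a null `ℚ`-semialgebraic subset is a
relation (domain additivity + `KZ.of_mem_relations_of_eqOn_zero` + `KZ.of_mem_relations_of_volume_eq_zero`). [folklore] -/
theorem of_mem_relations_of_eqOn_zero_off_null :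
    ∀ (n : ℕ) (g : KZ.IntegralRep n) (A : Set (Fin n → ℝ)), IsSemialgebraic ℚ A → A ⊆ g.domain →
      volume (g.domain \ A) = 0 → (∀ x ∈ A, g.integrand x = 0) → KZ.of g ∈ KZ.relations := by
  intro n g A hA hAg hnull hzero
  have hB : IsSemialgebraic ℚ (g.domain \ A) := g.isSemialgebraic_domain.diff hA
  set gA := g.restrict A hA hAg with hgA
  set gB := g.restrict (g.domain \ A) hB sdiff_subset with hgB
  have hsplit : KZ.of g - KZ.of gA - KZ.of gB ∈ KZ.relations := by
    refine KZ.domainAddRel_subset_relations ⟨n, g, gA, gB, ?_, ?_, fun _ _ => rfl, fun _ _ => rfl,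
      rfl⟩
    · simp only [hgA, hgB, KZ.IntegralRep.domain_restrict, union_sdiff_self]
      exact (union_eq_self_of_subset_left hAg).symm
    · simp only [hgA, hgB, KZ.IntegralRep.domain_restrict, inter_sdiff_self, measure_empty]
  have h1 : KZ.of gA ∈ KZ.relations :=
    KZ.of_mem_relations_of_eqOn_zero gA fun x hx => by simpa [hgA] using hzero x hx
  have h2 : KZ.of gB ∈ KZ.relations := KZ.of_mem_relations_of_volume_eq_zero gB hnull
  have : KZ.of g = (KZ.of g - KZ.of gA - KZ.of gB) + KZ.of gA + KZ.of gB := by abel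
  rw [this]
  exact KZ.relations.add_mem (KZ.relations.add_mem hsplit h1) h2

end Summit.KontsevichZagierPeriods.LiouvilleUnfolding.LogPrimitiveNL

end
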